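import Literature.MathematicalPhysics.PowerSystems.DAPISecondaryControlStabilityLoads
import Literature.Analysis.ODE.ExtendedInvariancePrinciple
import HarnessLib

/-!
# Existence of solutions of the differential-algebraic closed loops with load nodes from
# consistent initial data (SPDB2013 Theorem 2 (i) and Theorem 8 (ii), `V_L ≠ ∅`): the Kron-extended
# fields are `C¹` on the regular set, solutions are confined by the exponential estimate, global
# existence (Teschl Cor. 2.15), and the load constraints are invariant (Grönwall)

Topic `Literature/MathematicalPhysics/PowerSystems` (LADDER-GRIDFUSION rung G3 «inverter-based /
low-inertia»; seat gridfusion-lit-2, g11).  Companion of `DroopSyncExponentialStabilityLoads.lean`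
(Theorem 2 (i) WITH load nodes: `DroopNetwork.syncSolution_locally_expStable_loads` — EVERY solution
of the differential-algebraic closed loop (KuraDroop)–(PowerBal) starting `ρ`-close converges
exponentially to a rotation of the synchronized solution) and of
`DAPISecondaryControlStabilityLoads.lean` (Theorem 8 (ii) WITH load nodes:
`DAPINetwork.equilibrium_locally_expStable_loads_of_certificates`).  Those theorems quantify over
GIVEN solutions; this file proves that the solutions EXIST: from every CONSISTENT initial condition
(`P*_l = P_e,l(θ⁰)` at the loads) close to the equilibrium there is a solution of the
differential-algebraic system on `[0, ∞)`, and it obeys the exponential estimate.  Everything is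
PROVED (no named fact, no `sorry`).

THE ARGUMENT (the printed «`θ*` is a regular equilibrium point … solving the set of `|V_L|` algebraic
equations and substituting into the dynamics» made into an existence proof):
* §1 entries of `A(x)⁻¹ = det(A(x))⁻¹adj(A(x))` are `C¹` where `det A(x) ≠ 0` for a matrix of `C¹`
  functions (Leibniz formula; `contDiffOn_inv_entry`), and a linear equation `ẏ = −A(t)y`,
  `y(0) = 0`, with continuous coefficients has only the zero solution (`eq_zero_of_linear_of_eq_zero`,
  Grönwall — Mathlib's `eq_zero_of_abs_deriv_le_mul_abs_self_of_eq_zero_right`);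
* §2 the Kron-extended field `kronField θ*` of Theorem 2's file (inverter rows
  `(m_i − (L_IL(θ*)L_LL(θ*)⁻¹m_L)_i)/D_i`, load rows `G(θ)F_I + L_LL(θ*)⁻¹m_L`, `G = −L_LL⁻¹L_LI`)
  is `C¹` on the open regular set `{det L_LL(θ) ≠ 0}` (`contDiffOn_kronField`);
* §3 **`exists_kronSolution`**: every solution from `x` on any `[0, s]` is confined, by the estimate of
  `kron_expStable_modRotation_of_within_leaf`, to the compact ball
  `‖y − (θ* + c𝟙)‖ ≤ k‖x − (θ* + c𝟙)‖` inside the regular set, so the tree's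
  `Literature.Analysis.ODE.exists_global_solution_of_confined` (a `C¹` field whose solutions stay in a
  compact subset of its domain has global solutions, [Teschl2012, Cor. 2.15]) gives a solution on
  `[0, ∞)`, regular and obeying the estimate; **`mismatch_load_eq_zero_of_kronSolution`**: along it the
  load mismatches solve `ẏ = −L_LL(θ(t))L_LL(θ*)⁻¹y` (`lap_mulVec_kronField_load`: `L_LLG = −L_LI`
  kills the inverter velocities), hence vanish identically if they vanish at `t = 0`;
  **`exists_syncSolution_loads`** — THEOREM 2 (i) WITH LOAD NODES, EXISTENCE: `∃ ρ k λ > 0`, from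
  every consistent `θ⁰` with `‖θ⁰ − θ*‖ < ρ` there is `θ` with `θ(0) = θ⁰`, (KuraDroop)/(PowerBal) at
  every `t > 0` (`IsSolutionAt`), the load constraints at every `t ≥ 0`, continuous on `[0, ∞)`,
  and `‖θ(t) − (θ* + c𝟙 + ω_avg t𝟙)‖ ≤ k‖θ⁰ − (θ* + c𝟙)‖e^{−λt}`, `c = Σ D_i(θ⁰_i − θ*_i)/Σ D_i`;
* §4 the same for the DAPI closed loop with loads: `contDiffOn_dlField`, **`exists_dlSolution`**,
  `lap_mulVec_dlField_load`, **`mismatch_load_eq_zero_of_dlSolution`** and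
  **`exists_solution_loads`** — THEOREM 8 (ii) WITH LOAD NODES, EXISTENCE: from every consistent
  `(θ⁰, p⁰)` with `‖(θ⁰ − θ*, p⁰ − D_Iω_avg)‖ < ρ` there is a solution `(θ, p)` of (load – closed
  loop)–(secondary control – closed loop) on `[0, ∞)` (`IsSolutionLoadsAt` at every `t > 0`,
  constraints at every `t ≥ 0`, continuous state) with
  `‖(θ(t) − (θ* + c𝟙), p(t) − D_Iω_avg)‖ ≤ k‖(θ⁰ − (θ* + c𝟙), p⁰ − D_Iω_avg)‖e^{−λt}`,
  `c = (Σ D_i(θ⁰_i − θ*_i) − Σ_{V_I} k_i(p⁰_i − D_iω_avg))/Σ D_i`.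

THREE COLUMNS.  Mathematics about the MODELS (KuraDroop)–(PowerBal) and (load – closed
loop)–(secondary control – closed loop): lossless lines, constant voltage amplitudes, constant-power
loads as algebraic rows.  Solutions are CLASSICAL (load angles differentiable); the equations hold at
every `t > 0` and the state is continuous on `[0, ∞)` (at `t = 0` only the right derivative exists).
Uniqueness of the DAE solution is not asserted here.  Nothing here says a microgrid is stable.

## Mathlib / tree search

Tree (used by name): `Literature.Analysis.ODE.exists_global_solution_of_confined`
(`ExtendedInvariancePrinciple.lean`, from `ConfinedAutonomous.exists_solution_of_confined`),
`DroopNetwork.{kron_expStable_within_leaf, kron_expStable_modRotation_of_within_leaf,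
exists_ball_isUnit_lapLL, isUnit_lapLL_det, lapLL_mul_elim, hasFDerivAt_mismatch, mismatch_add_const,
dc_load, lap_mulVec}`, `DAPINetwork.{dl_expStable_within_leaf, dl_expStable_modRotation_of_within_leaf,
IsSolutionLoadsAt, dlField, lphase, dlWeights, dlRot}`.  Mathlib: `Matrix.det_apply'`,
`Matrix.adjugate_apply`, `Matrix.inv_def`, `ContDiff.sum`, `contDiff_prod`, `ContDiffOn.inv`,
`eq_zero_of_abs_deriv_le_mul_abs_self_of_eq_zero_right` (Grönwall), `isCompact_closedBall`.

## References

* J. W. Simpson-Porco, F. Dörfler, F. Bullo, *Synchronization and power sharing for droop-controlled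
  inverters in islanded microgrids*, Automatica 49 (2013) 2603–2611 = arXiv:1206.5033, §3 Theorem 2
  and proof of (b) (held text p0008 L23–L49: «`θ*` is a regular equilibrium point», «solving the set
  of `|V_L|` algebraic equations and substituting into the dynamics»), §5 Theorem 8 and App. C
  (p0016 L1–L40). [SimpsonporcoDorflerBullo2013]
* G. Teschl, *Ordinary Differential Equations and Dynamical Systems*, AMS GSM 140 (2012), Cor. 2.15.
  [Teschl2012]

AI-produced formalisation (LADDER-GRIDFUSION seat gridfusion-lit-2 g11, 2026-08-28).
-/

noncomputable section

open Set Filter Topology Finset Metric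
open scoped Matrix BigOperators

namespace Literature.MathematicalPhysics.PowerSystems

/-! ## §1 Entries of the inverse of a matrix of `C¹` functions are `C¹` where the determinant does
not vanish -/

section MatrixEntries

variable {X : Type*} [NormedAddCommGroup X] [NormedSpace ℝ X] {m : Type*} [Fintype m]
  [DecidableEq m]

/-- The determinant of a matrix of `C¹` functions is `C¹` (Leibniz formula). [folklore] -/
private theorem contDiff_det_of_entries {A : X → Matrix m m ℝ} (h : ∀ a b, ContDiff ℝ 1 fun x => A x a b) :
    ContDiff ℝ 1 fun x => (A x).det := by
  have hform : (fun x => (A x).det)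
      = fun x => ∑ σ : Equiv.Perm m, ((Equiv.Perm.sign σ : ℤ) : ℝ) * ∏ i, A x (σ i) i := by
    funext x; exact Matrix.det_apply' (A x)
  rw [hform]
  refine ContDiff.sum fun σ _ => ?_
  exact contDiff_const.mul (contDiff_prod fun i _ => h (σ i) i)

/-- The adjugate of a matrix of `C¹` functions has `C¹` entries. [folklore] -/
private theorem contDiff_adjugate_of_entries {A : X → Matrix m m ℝ}
    (h : ∀ a b, ContDiff ℝ 1 fun x => A x a b) (a b : m) :
    ContDiff ℝ 1 fun x => (A x).adjugate a b := by
  have hform : (fun x => (A x).adjugate a b)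
      = fun x => ((A x).updateRow b (Pi.single a 1)).det := by
    funext x; exact Matrix.adjugate_apply (A x) a b
  rw [hform]
  refine contDiff_det_of_entries fun a' b' => ?_
  by_cases hab : a' = b
  · simp only [Matrix.updateRow_apply, hab, if_true]
    exact contDiff_const
  · simp only [Matrix.updateRow_apply, hab, if_false]
    exact h a' b'

/-- **The entries of `A(x)⁻¹` are `C¹` on `{det A(x) ≠ 0}`** for a matrix of `C¹` functions
(`A⁻¹ = det(A)⁻¹ · adj(A)`). [folklore] -/
private theorem contDiffOn_inv_entry {A : X → Matrix m m ℝ} (h : ∀ a b, ContDiff ℝ 1 fun x => A x a b)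
    (a b : m) : ContDiffOn ℝ 1 (fun x => (A x)⁻¹ a b) {x | (A x).det ≠ 0} := by
  have hform : (fun x => (A x)⁻¹ a b) = fun x => ((A x).det)⁻¹ * (A x).adjugate a b := by
    funext x
    rw [Matrix.inv_def, Ring.inverse_eq_inv, Matrix.smul_apply, smul_eq_mul]
  rw [hform]
  exact ((contDiff_det_of_entries h).contDiffOn.inv fun x hx => hx).mul
    (contDiff_adjugate_of_entries h a b).contDiffOn

/-- `{det A(x) ≠ 0}` is open. [folklore] -/
private theorem isOpen_det_ne_zero {A : X → Matrix m m ℝ} (h : ∀ a b, ContDiff ℝ 1 fun x => A x a b) :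
    IsOpen {x | (A x).det ≠ 0} :=
  isOpen_ne_fun (contDiff_det_of_entries h).continuous continuous_const

end MatrixEntries

/-! ### A linear equation `ẏ = −A(t)y` with continuous coefficients and `y(0) = 0` has only the
zero solution on `[0, T]` (Grönwall) -/

/-- `ẏ = −A(t)y` within `[0, T]`, `A` continuous entrywise on `[0, T]`, `y(0) = 0` ⇒ `y ≡ 0` on
`[0, T]`. [folklore] -/
private theorem eq_zero_of_linear_of_eq_zero {ι : Type*} [Fintype ι] {y : ℝ → ι → ℝ}
    {A : ℝ → Matrix ι ι ℝ} {T : ℝ}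
    (hy : ∀ t ∈ Icc 0 T, HasDerivWithinAt y (-(A t *ᵥ y t)) (Icc 0 T) t)
    (hA : ∀ a b, ContinuousOn (fun t => A t a b) (Icc 0 T)) (h0 : y 0 = 0) :
    ∀ t ∈ Icc 0 T, y t = 0 := by
  classical
  have hycont : ContinuousOn y (Icc 0 T) := fun t ht => (hy t ht).continuousWithinAt
  -- a uniform bound for the coefficients on `[0, T]`
  have hbd : ∀ a b : ι, ∃ C, ∀ t ∈ Icc 0 T, |A t a b| ≤ C := fun a b => by
    obtain ⟨C, hC⟩ := isCompact_Icc.exists_bound_of_continuousOn (hA a b)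
    exact ⟨C, fun t ht => by simpa [Real.norm_eq_abs] using hC t ht⟩
  choose C hC using hbd
  set Kb : ℝ := ∑ a, ∑ b, |C a b| with hKb
  have hbound : ∀ t ∈ Ico 0 T, ‖-(A t *ᵥ y t)‖ ≤ Kb * ‖y t‖ := by
    intro t ht
    have ht' : t ∈ Icc 0 T := ⟨ht.1, ht.2.le⟩
    rw [norm_neg]
    refine (pi_norm_le_iff_of_nonneg (by positivity)).2 fun a => ?_
    rw [Real.norm_eq_abs]
    calc |(A t *ᵥ y t) a| = |∑ b, A t a b * y t b| := rfl
      _ ≤ ∑ b, |A t a b * y t b| := Finset.abs_sum_le_sum_abs _ _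
      _ ≤ ∑ b, |C a b| * ‖y t‖ := Finset.sum_le_sum fun b _ => by
          rw [abs_mul]
          refine mul_le_mul ((hC a b t ht').trans (le_abs_self _)) ?_ (abs_nonneg _) (abs_nonneg _)
          simpa [Real.norm_eq_abs] using norm_le_pi_norm (y t) b
      _ = (∑ b, |C a b|) * ‖y t‖ := by rw [Finset.sum_mul]
      _ ≤ Kb * ‖y t‖ := by
          refine mul_le_mul_of_nonneg_right ?_ (norm_nonneg _)
          rw [hKb]
          exact Finset.single_le_sum (f := fun a => ∑ b, |C a b|)
            (fun a _ => Finset.sum_nonneg fun b _ => abs_nonneg _) (Finset.mem_univ a)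
  have hy' : ∀ t ∈ Ico 0 T, HasDerivWithinAt y (-(A t *ᵥ y t)) (Ici t) t := by
    intro t ht
    refine (hy t ⟨ht.1, ht.2.le⟩).mono_of_mem_nhdsWithin ?_
    exact mem_of_superset (Icc_mem_nhdsGE ht.2) (Icc_subset_Icc ht.1 le_rfl)
  exact eq_zero_of_abs_deriv_le_mul_abs_self_of_eq_zero_right hycont hy' h0 hbound

namespace DroopNetwork

variable {n : ℕ} {N : DroopNetwork n}

/-! ## §2 The Kron-extended field of Theorem 2 (with load nodes) is `C¹` on the regular set
`{θ | det L_LL(θ) ≠ 0}` -/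

/-- The linearised weights `a_ij cos(θ_i − θ_j)` are `C¹` in `θ`.
[cite: SimpsonporcoDorflerBullo2013, §3 proof of Theorem 2 (b) (the weights of `L(θ*)`)] -/
theorem contDiff_linWeight (i j : Fin n) : ContDiff ℝ 1 fun θ : Fin n → ℝ => N.linWeight θ i j := by
  unfold linWeight
  exact contDiff_const.mul (((contDiff_apply ℝ ℝ i).sub (contDiff_apply ℝ ℝ j)).cos)

/-- The entries of `L(θ)` are `C¹` in `θ`.
[cite: SimpsonporcoDorflerBullo2013, §3 proof of Theorem 2 (b) (definition of `L(θ*)`)] -/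
theorem contDiff_lap (i j : Fin n) : ContDiff ℝ 1 fun θ : Fin n → ℝ => N.lap θ i j := by
  unfold lap
  by_cases hij : i = j
  · simp only [hij, if_true]
    exact (ContDiff.sum fun k _ => contDiff_linWeight j k).sub (contDiff_linWeight j j)
  · simp only [hij, if_false, zero_sub]
    exact (contDiff_linWeight i j).neg

/-- The mismatch `P̃_i − P_e,i(θ)` is `C¹` in `θ`.
[cite: SimpsonporcoDorflerBullo2013, §3 proof of Theorem 2 (b) (eq. (Aux))] -/
theorem contDiff_mismatch (i : Fin n) : ContDiff ℝ 1 fun θ : Fin n → ℝ => N.mismatch θ i := by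
  unfold mismatch injection
  exact contDiff_const.sub (ContDiff.sum fun j _ =>
    contDiff_const.mul (((contDiff_apply ℝ ℝ i).sub (contDiff_apply ℝ ℝ j)).sin))

/-- The entries of the elimination matrix `G(θ) = −L_LL(θ)⁻¹L_LI(θ)` are `C¹` on the regular set.
[cite: SimpsonporcoDorflerBullo2013, §3 proof of Theorem 2 (b) («`θ*` is a regular equilibrium point»)] -/
theorem contDiffOn_elim (l : N.Load) (i : N.Inv) :
    ContDiffOn ℝ 1 (fun θ : Fin n → ℝ => N.elim θ l i) {θ | (N.lapLL θ).det ≠ 0} := by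
  have hLL : ∀ a b : N.Load, ContDiff ℝ 1 fun θ : Fin n → ℝ => N.lapLL θ a b :=
    fun a b => contDiff_lap a.1 b.1
  have hform : (fun θ : Fin n → ℝ => N.elim θ l i)
      = fun θ => -∑ l', (N.lapLL θ)⁻¹ l l' * N.lapLI θ l' i := by
    funext θ; simp [elim, Matrix.mul_apply]
  rw [hform]
  refine ContDiffOn.neg (ContDiffOn.sum fun l' _ => ?_)
  exact (contDiffOn_inv_entry hLL l l').mul (contDiff_lap l'.1 i.1).contDiffOn

/-- The inverter rows `F_I(θ)` of the extension are `C¹` everywhere (the correction uses the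
CONSTANT matrix `L_IL(θ*)L_LL(θ*)⁻¹`). [cite: SimpsonporcoDorflerBullo2013, §3 proof of Theorem 2 (b)] -/
theorem contDiff_kronFieldI (θs : Fin n → ℝ) (i : N.Inv) :
    ContDiff ℝ 1 fun θ : Fin n → ℝ => N.kronFieldI θs θ i := by
  unfold kronFieldI
  refine ContDiff.div_const (ContDiff.sub (contDiff_mismatch i.1) ?_) _
  simp only [Matrix.mulVec, dotProduct]
  exact ContDiff.sum fun l _ => contDiff_const.mul (contDiff_mismatch l.1)

/-- The load rows `F_L(θ) = G(θ)F_I(θ) + L_LL(θ*)⁻¹m_L(θ)` are `C¹` on the regular set.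
[cite: SimpsonporcoDorflerBullo2013, §3 proof of Theorem 2 (b)] -/
theorem contDiffOn_kronFieldL (θs : Fin n → ℝ) (l : N.Load) :
    ContDiffOn ℝ 1 (fun θ : Fin n → ℝ => N.kronFieldL θs θ l) {θ | (N.lapLL θ).det ≠ 0} := by
  unfold kronFieldL
  simp only [Pi.add_apply, Matrix.mulVec, dotProduct]
  refine ContDiffOn.add (ContDiffOn.sum fun i _ => ?_) (ContDiffOn.sum fun l' _ => ?_)
  · exact (contDiffOn_elim l i).mul (contDiff_kronFieldI θs i).contDiffOn
  · exact (contDiff_const.mul (contDiff_mismatch l'.1)).contDiffOn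

/-- **The Kron-extended field `F = kronField θ*` is `C¹` on the regular set `{det L_LL(θ) ≠ 0}`**,
an open set. [cite: SimpsonporcoDorflerBullo2013, §3 proof of Theorem 2 (b)] -/
theorem contDiffOn_kronField (θs : Fin n → ℝ) :
    ContDiffOn ℝ 1 (N.kronField θs) {θ | (N.lapLL θ).det ≠ 0} := by
  refine contDiffOn_pi' fun j => ?_
  by_cases hj : 0 < N.Dc j
  · have : (fun θ => N.kronField θs θ j) = fun θ => N.kronFieldI θs θ ⟨j, hj⟩ := by
      funext θ; simp only [kronField, dif_pos hj]
    rw [this]; exact (contDiff_kronFieldI θs ⟨j, hj⟩).contDiffOn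
  · have : (fun θ => N.kronField θs θ j) = fun θ => N.kronFieldL θs θ ⟨j, hj⟩ := by
      funext θ; simp only [kronField, dif_neg hj]
    rw [this]; exact contDiffOn_kronFieldL θs ⟨j, hj⟩

/-- The regular set `{θ | det L_LL(θ) ≠ 0}` is open.
[cite: SimpsonporcoDorflerBullo2013, §3 proof of Theorem 2 (b) («`θ*` is a regular equilibrium point»)] -/
theorem isOpen_regular : IsOpen {θ : Fin n → ℝ | (N.lapLL θ).det ≠ 0} :=
  isOpen_det_ne_zero fun a b => contDiff_lap a.1 b.1

/-! ## §3 Theorem 2 (i) with load nodes: solutions of the Kron-extended flow EXIST from every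
initial state near `θ*`, stay regular, obey the exponential estimate; the load constraints are
invariant; from CONSISTENT initial data the differential-algebraic closed loop has a solution on
`[0, ∞)` converging exponentially to the synchronized solution -/

/-- `|Σ D_i h_i| ≤ (Σ D_i)‖h‖` for `D ≥ 0` (sup norm). [folklore] -/
private theorem abs_dc_dotProduct_le'' (hD : ∀ i, 0 ≤ N.Dc i) (h : Fin n → ℝ) :
    |N.Dc ⬝ᵥ h| ≤ (∑ i, N.Dc i) * ‖h‖ := by
  calc |N.Dc ⬝ᵥ h| = |∑ i, N.Dc i * h i| := rfl
    _ ≤ ∑ i, |N.Dc i * h i| := Finset.abs_sum_le_sum_abs _ _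
    _ ≤ ∑ i, N.Dc i * ‖h‖ := Finset.sum_le_sum fun i _ => by
        rw [abs_mul, abs_of_nonneg (hD i)]
        exact mul_le_mul_of_nonneg_left (by simpa using norm_le_pi_norm h i) (hD i)
    _ = (∑ i, N.Dc i) * ‖h‖ := by rw [Finset.sum_mul]

/-- **Solutions of the Kron-extended flow exist on `[0, ∞)` from every initial state near `θ*`**,
stay in the regular set (`L_LL(X(t))` invertible) and obey the exponential estimate modulo the
rotation.  Hypotheses as in `syncSolution_locally_expStable_loads` (`|Y|` symmetric, `D ≥ 0`, one
inverter, (Aux)-equilibrium `θ*` with the PSD + kernel certificate).  Proof: the field is `C¹` on the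
open regular set (§2), every solution from `x` on any `[0, s]` is confined to the compact ball
`‖y − (θ* + c𝟙)‖ ≤ k‖x − (θ* + c𝟙)‖` inside the regular set by the estimate of
`kron_expStable_modRotation_of_within_leaf`, and a `C¹` field with solutions confined to a compact
subset of its domain has global solutions (`Literature.Analysis.ODE.exists_global_solution_of_confined`,
Teschl Cor. 2.15).
[cite: SimpsonporcoDorflerBullo2013, §3 Theorem 2 (i) and proof of (b) («`θ*` is a regular equilibrium point»); Teschl2012, Cor. 2.15] -/
theorem exists_kronSolution (hY : ∀ i j, N.Yabs i j = N.Yabs j i) (hD : ∀ i, 0 ≤ N.Dc i)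
    (i₀ : N.Inv) {θs : Fin n → ℝ} (hθs : N.IsAuxEquilibrium θs)
    (hpsd : ∀ u : Fin n → ℝ, 0 ≤ ∑ i, u i * ∑ j, N.linWeight θs i j * (u i - u j))
    (hker : ∀ u : Fin n → ℝ, ∑ i, u i * ∑ j, N.linWeight θs i j * (u i - u j) = 0 →
      ∃ a : ℝ, u = fun _ => a) :
    ∃ ρ > 0, ∃ k > 0, ∃ lam > 0, ∀ x : Fin n → ℝ, ‖x - θs‖ < ρ →
      ∃ X : ℝ → Fin n → ℝ, X 0 = x ∧
        (∀ T : ℝ, ∀ t ∈ Icc 0 T, HasDerivWithinAt X (N.kronField θs (X t)) (Icc 0 T) t) ∧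
        (∀ t : ℝ, 0 ≤ t → IsUnit (N.lapLL (X t)).det) ∧
        ∀ t : ℝ, 0 ≤ t → ‖X t - fun i => θs i + N.Dc ⬝ᵥ (x - θs) / ∑ i, N.Dc i‖
          ≤ k * ‖x - fun i => θs i + N.Dc ⬝ᵥ (x - θs) / ∑ i, N.Dc i‖ * Real.exp (-lam * t) := by
  classical
  obtain ⟨ρ, hρ, k, hk, lam, hlam, H⟩ := kron_expStable_within_leaf hY hD i₀ hθs hpsd hker
  have Hmod := kron_expStable_modRotation_of_within_leaf hD i₀ H
  have hDs : 0 < ∑ i, N.Dc i :=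
    lt_of_lt_of_le i₀.2 (Finset.single_le_sum (fun i _ => hD i) (Finset.mem_univ i₀.1))
  have hU0 : IsUnit (N.lapLL θs).det := isUnit_lapLL_det hker i₀
  obtain ⟨r, hr, hball⟩ := exists_ball_isUnit_lapLL hU0
  set ρ' : ℝ := min (ρ / 2) (r / (2 * k + 2)) with hρ'
  have hρ'pos : 0 < ρ' := lt_min (by positivity) (by positivity)
  have hρ'ρ : ρ' ≤ ρ / 2 := min_le_left _ _
  have hρ'r : (2 * k + 2) * ρ' ≤ r := by
    have := min_le_right (ρ / 2) (r / (2 * k + 2))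
    rw [← hρ'] at this
    calc (2 * k + 2) * ρ' ≤ (2 * k + 2) * (r / (2 * k + 2)) :=
          mul_le_mul_of_nonneg_left this (by positivity)
      _ = r := by field_simp
  refine ⟨ρ', hρ'pos, k, hk, lam, hlam, fun x hx => ?_⟩
  -- the rotation selected by `x` and the confining ball
  set c : ℝ := N.Dc ⬝ᵥ (x - θs) / ∑ i, N.Dc i with hcdef
  set xc : Fin n → ℝ := fun i => θs i + c with hxc
  have hcle : |c| ≤ ‖x - θs‖ := by
    rw [hcdef, abs_div, abs_of_pos hDs, div_le_iff₀ hDs]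
    calc |N.Dc ⬝ᵥ (x - θs)| ≤ (∑ i, N.Dc i) * ‖x - θs‖ := abs_dc_dotProduct_le'' hD _
      _ = ‖x - θs‖ * ∑ i, N.Dc i := mul_comm _ _
  have hB0 : ‖x - xc‖ ≤ 2 * ρ' := by
    have hdecomp : x - xc = (x - θs) - fun _ => c := by funext i; simp [hxc]; ring
    rw [hdecomp]
    calc ‖(x - θs) - fun _ : Fin n => c‖ ≤ ‖x - θs‖ + ‖fun _ : Fin n => c‖ := norm_sub_le _ _
      _ ≤ ‖x - θs‖ + |c| := by
          gcongr; exact (pi_norm_const_le c).trans (le_of_eq (Real.norm_eq_abs c))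
      _ ≤ 2 * ρ' := by linarith [hx.le]
  set K : Set (Fin n → ℝ) := closedBall xc (k * ‖x - xc‖) with hKdef
  have hKcpt : IsCompact K := isCompact_closedBall _ _
  have hKO : K ⊆ {θ : Fin n → ℝ | (N.lapLL θ).det ≠ 0} := by
    intro y hy
    rw [hKdef, mem_closedBall, dist_eq_norm] at hy
    have hlt : ‖y - fun j => θs j + c‖ < r := by
      calc ‖y - fun j => θs j + c‖ ≤ k * ‖x - xc‖ := hy
        _ ≤ k * (2 * ρ') := mul_le_mul_of_nonneg_left hB0 hk.le
        _ < r := by nlinarith [hρ'r, hρ'pos]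
    exact (hball y c hlt).ne_zero
  -- every solution from `x` is confined to `K`
  have hconf : ∀ s : ℝ, ∀ X : ℝ → Fin n → ℝ, X 0 = x →
      (∀ t ∈ Icc 0 s, HasDerivWithinAt X (N.kronField θs (X t)) (Icc 0 s) t) →
      ∀ t ∈ Icc 0 s, X t ∈ K := by
    intro s X hX0 hX t ht
    have h0 : ‖X 0 - θs‖ < ρ / 2 := by rw [hX0]; exact lt_of_lt_of_le hx hρ'ρ
    have hest := Hmod X s hX h0 t ht
    rw [hX0] at hest
    rw [hKdef, mem_closedBall, dist_eq_norm]
    have hexp : Real.exp (-lam * t) ≤ 1 := Real.exp_le_one_iff.2 (by nlinarith [ht.1])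
    calc ‖X t - xc‖ ≤ k * ‖x - xc‖ * Real.exp (-lam * t) := hest
      _ ≤ k * ‖x - xc‖ := mul_le_of_le_one_right (by positivity) hexp
  obtain ⟨X, hX0, hX⟩ := Literature.Analysis.ODE.exists_global_solution_of_confined
    isOpen_regular (contDiffOn_kronField θs) hKcpt hKO hconf
  refine ⟨X, hX0, hX, fun t ht => ?_, fun t ht => ?_⟩
  · exact isUnit_iff_ne_zero.2 (hKO (hconf t X hX0 (hX t) t ⟨ht, le_rfl⟩))
  · have h0 : ‖X 0 - θs‖ < ρ / 2 := by rw [hX0]; exact lt_of_lt_of_le hx hρ'ρ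
    have hest := Hmod X t (hX t) h0 t ⟨ht, le_rfl⟩
    rw [hX0] at hest
    exact hest

/-- Splitting a sum over the nodes into inverter and load nodes. [folklore] -/
private theorem sum_split'' {M : Type*} [AddCommMonoid M] (f : Fin n → M) :
    ∑ j, f j = ∑ i : N.Inv, f i.1 + ∑ l : N.Load, f l.1 :=
  (Fintype.sum_subtype_add_sum_subtype (fun j => 0 < N.Dc j) f).symm

/-- The derivative of the mismatch, applied: `−(L(θ)h)_i`. [folklore] -/
private theorem mismatchDeriv_apply'' (θs : Fin n → ℝ) (i : Fin n) (h : Fin n → ℝ) :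
    ((-(∑ j, N.linWeight θs i j •
        ((ContinuousLinearMap.proj i : (Fin n → ℝ) →L[ℝ] ℝ) - ContinuousLinearMap.proj j)))
        : (Fin n → ℝ) →L[ℝ] ℝ) h
      = -((N.lap θs *ᵥ h) i) := by
  rw [lap_mulVec]
  simp only [neg_apply, _root_.sum_apply, smul_apply, sub_apply, ContinuousLinearMap.proj_apply,
    smul_eq_mul]

/-- Along the extension field the load mismatches obey a LINEAR equation: at a regular `θ`,
`(L(θ)F(θ))_l = (L_LL(θ)L_LL(θ*)⁻¹ m_L(θ))_l` (`L_LLG = −L_LI` kills the inverter velocities).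
[cite: SimpsonporcoDorflerBullo2013, §3 proof of Theorem 2 (b)] -/
theorem lap_mulVec_kronField_load (θs : Fin n → ℝ) {θ : Fin n → ℝ} (hU : IsUnit (N.lapLL θ).det)
    (l : N.Load) :
    (N.lap θ *ᵥ N.kronField θs θ) l.1
      = ((N.lapLL θ * (N.lapLL θs)⁻¹) *ᵥ fun l' : N.Load => N.mismatch θ l'.1) l := by
  classical
  have hFI : ∀ i : N.Inv, N.kronField θs θ i.1 = N.kronFieldI θs θ i := fun i => by
    simp only [kronField, dif_pos i.2]
  have hFL : ∀ l' : N.Load, N.kronField θs θ l'.1 = N.kronFieldL θs θ l' := fun l' => by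
    simp only [kronField, dif_neg l'.2]
  have h1 : (N.lap θ *ᵥ N.kronField θs θ) l.1
      = (N.lapLI θ *ᵥ N.kronFieldI θs θ) l + (N.lapLL θ *ᵥ N.kronFieldL θs θ) l := by
    simp only [Matrix.mulVec, dotProduct]
    rw [sum_split'' (N := N)]
    simp only [lapLI, lapLL, hFI, hFL]
  have h2 : N.lapLL θ *ᵥ N.kronFieldL θs θ
      = -(N.lapLI θ *ᵥ N.kronFieldI θs θ)
        + (N.lapLL θ * (N.lapLL θs)⁻¹) *ᵥ fun l' : N.Load => N.mismatch θ l'.1 := by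
    rw [kronFieldL, Matrix.mulVec_add, Matrix.mulVec_mulVec, Matrix.mulVec_mulVec,
      lapLL_mul_elim hU, Matrix.neg_mulVec]
  rw [h1, h2, Pi.add_apply, Pi.neg_apply]
  ring

/-- **The load constraints are invariant**: a solution of the Kron-extended flow on `[0, T]` which
stays regular and starts on the constraint manifold `m_L(X(0)) = 0` stays on it — `y = m_L(X(t))`
solves the linear equation `ẏ = −L_LL(X(t))L_LL(θ*)⁻¹y`, `y(0) = 0`, so `y ≡ 0` (Grönwall).
[cite: SimpsonporcoDorflerBullo2013, §3 proof of Theorem 2 (b) («solving the set of `|V_L|` algebraic equations and substituting into the dynamics»)] -/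
theorem mismatch_load_eq_zero_of_kronSolution (θs : Fin n → ℝ) {X : ℝ → Fin n → ℝ} {T : ℝ}
    (hX : ∀ t ∈ Icc 0 T, HasDerivWithinAt X (N.kronField θs (X t)) (Icc 0 T) t)
    (hU : ∀ t ∈ Icc 0 T, IsUnit (N.lapLL (X t)).det)
    (h0 : ∀ l : N.Load, N.mismatch (X 0) l.1 = 0) :
    ∀ t ∈ Icc 0 T, ∀ l : N.Load, N.mismatch (X t) l.1 = 0 := by
  classical
  set y : ℝ → N.Load → ℝ := fun t l => N.mismatch (X t) l.1 with hydef
  set A : ℝ → Matrix N.Load N.Load ℝ := fun t => N.lapLL (X t) * (N.lapLL θs)⁻¹ with hAdef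
  -- the linear equation
  have hyderiv : ∀ t ∈ Icc 0 T, HasDerivWithinAt y (-(A t *ᵥ y t)) (Icc 0 T) t := by
    intro t ht
    refine hasDerivWithinAt_pi.2 fun l => ?_
    have h1 : HasDerivWithinAt (fun s => N.mismatch (X s) l.1)
        (((-(∑ j, N.linWeight (X t) l.1 j •
          ((ContinuousLinearMap.proj l.1 : (Fin n → ℝ) →L[ℝ] ℝ) - ContinuousLinearMap.proj j)))
            : (Fin n → ℝ) →L[ℝ] ℝ) (N.kronField θs (X t))) (Icc 0 T) t :=
      (hasFDerivAt_mismatch (X t) l.1).comp_hasDerivWithinAt t (hX t ht)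
    rw [mismatchDeriv_apply'', lap_mulVec_kronField_load θs (hU t ht) l] at h1
    exact h1
  -- continuity of the coefficients
  have hXcont : ContinuousOn X (Icc 0 T) := fun t ht => (hX t ht).continuousWithinAt
  have hAcont : ∀ a b : N.Load, ContinuousOn (fun t => A t a b) (Icc 0 T) := by
    intro a b
    have hform : (fun t => A t a b) = fun t => ∑ l', N.lapLL (X t) a l' * (N.lapLL θs)⁻¹ l' b := by
      funext t; simp [hAdef, Matrix.mul_apply]
    rw [hform]
    refine continuousOn_finsetSum _ fun l' _ => ContinuousOn.mul ?_ continuousOn_const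
    exact ((contDiff_lap a.1 l'.1).continuous).comp_continuousOn hXcont
  have hy0 : y 0 = 0 := funext fun l => h0 l
  have hzero := eq_zero_of_linear_of_eq_zero hyderiv hAcont hy0
  intro t ht l
  have := congrFun (hzero t ht) l
  simpa [hydef] using this

/-- **SPDB2013 Theorem 2 (i) WITH LOAD NODES — existence of the motions and their convergence.**
Under the hypotheses of `syncSolution_locally_expStable_loads` there are `ρ, k, λ > 0` such that from
EVERY CONSISTENT initial angle array `θ⁰` (`P*_l = P_e,l(θ⁰)` at the loads) with `‖θ⁰ − θ*‖ < ρ`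
there is a solution `θ` of the differential-algebraic closed loop on `[0, ∞)` — `θ(0) = θ⁰`,
(KuraDroop) at the inverters and (PowerBal) at the loads at every `t > 0` (`IsSolutionAt`), the load
constraints at every `t ≥ 0`, `θ` continuous on `[0, ∞)` — and it satisfies for all `t ≥ 0`
`‖θ(t) − (θ* + c𝟙 + ω_avg t𝟙)‖ ≤ k‖θ⁰ − (θ* + c𝟙)‖e^{−λt}`, `c = Σ_i D_i(θ⁰_i − θ*_i)/Σ_i D_i`.
(So the «EVERY solution» clause of `syncSolution_locally_expStable_loads` is not vacuous.)  MODEL: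
(KuraDroop) at inverters + (PowerBal) at constant-power loads, lossless, constant voltages.
[cite: SimpsonporcoDorflerBullo2013, §3 Theorem 2 (i) («locally exponentially stable … synchronized solution») and proof of (b); Teschl2012, Cor. 2.15] -/
theorem exists_syncSolution_loads (hY : ∀ i j, N.Yabs i j = N.Yabs j i) (hD : ∀ i, 0 ≤ N.Dc i)
    (i₀ : N.Inv) {θ₀ : Fin n → ℝ} (hθ₀ : N.IsAuxEquilibrium θ₀)
    (hpsd : ∀ u : Fin n → ℝ, 0 ≤ ∑ i, u i * ∑ j, N.linWeight θ₀ i j * (u i - u j))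
    (hker : ∀ u : Fin n → ℝ, ∑ i, u i * ∑ j, N.linWeight θ₀ i j * (u i - u j) = 0 →
      ∃ a : ℝ, u = fun _ => a) :
    ∃ ρ > 0, ∃ k > 0, ∃ lam > 0, ∀ θinit : Fin n → ℝ, ‖θinit - θ₀‖ < ρ →
      (∀ l : N.Load, N.Pstar l.1 = N.injection θinit l.1) →
      ∃ θ : ℝ → Fin n → ℝ, θ 0 = θinit ∧ (∀ t : ℝ, 0 < t → N.IsSolutionAt θ t) ∧
        (∀ t : ℝ, 0 ≤ t → ∀ l : N.Load, N.Pstar l.1 = N.injection (θ t) l.1) ∧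
        ContinuousOn θ (Ici 0) ∧
        ∀ t : ℝ, 0 ≤ t →
          ‖θ t - fun i => θ₀ i + N.Dc ⬝ᵥ (θinit - θ₀) / (∑ i, N.Dc i) + N.avgFrequency * t‖
            ≤ k * ‖θinit - fun i => θ₀ i + N.Dc ⬝ᵥ (θinit - θ₀) / ∑ i, N.Dc i‖
              * Real.exp (-lam * t) := by
  classical
  obtain ⟨ρ, hρ, k, hk, lam, hlam, H⟩ := exists_kronSolution hY hD i₀ hθ₀ hpsd hker
  refine ⟨ρ, hρ, k, hk, lam, hlam, fun θinit hinit hcons => ?_⟩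
  obtain ⟨X, hX0, hX, hXU, hXest⟩ := H θinit hinit
  -- the load constraints along `X`
  have hmis : ∀ (l : N.Load) (θ : Fin n → ℝ),
      N.mismatch θ l.1 = N.Pstar l.1 - N.injection θ l.1 := fun l θ => by
    rw [mismatch, shiftedInjection, dc_load hD l, mul_zero, sub_zero]
  have hm0 : ∀ l : N.Load, N.mismatch (X 0) l.1 = 0 := fun l => by
    rw [hX0, hmis, hcons l, sub_self]
  have hmL : ∀ t, 0 ≤ t → ∀ l : N.Load, N.mismatch (X t) l.1 = 0 := fun t ht =>
    mismatch_load_eq_zero_of_kronSolution θ₀ (hX t) (fun s hs => hXU s hs.1) hm0 t ⟨ht, le_rfl⟩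
  -- the motion in the original frame
  set θ : ℝ → Fin n → ℝ := fun s j => X s j + N.avgFrequency * s with hθdef
  have hinj : ∀ s, N.injection (θ s) = N.injection (X s) := fun s => by
    have h := mismatch_add_const (N := N) (X s) (N.avgFrequency * s)
    funext j
    have hj := congrFun h j
    simp only [mismatch] at hj
    simpa [hθdef] using hj
  refine ⟨θ, ?_, fun t ht j => ?_, fun t ht l => ?_, ?_, fun t ht => ?_⟩
  · funext j; simp [hθdef, hX0]
  · -- (KuraDroop) / (PowerBal) at time `t > 0`
    have hder : HasDerivAt X (N.kronField θ₀ (X t)) t :=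
      (hX (t + 1) t ⟨ht.le, by linarith⟩).hasDerivAt (Icc_mem_nhds ht (by linarith))
    have hderj : HasDerivAt (fun s => θ s j) (N.kronField θ₀ (X t) j + N.avgFrequency) t := by
      have h1 : HasDerivAt (fun s => X s j) (N.kronField θ₀ (X t) j) t := hasDerivAt_pi.1 hder j
      have h2 : HasDerivAt (fun s : ℝ => N.avgFrequency * s) N.avgFrequency t := by
        simpa using (hasDerivAt_id t).const_mul N.avgFrequency
      exact h1.add h2
    refine ⟨_, hderj, ?_⟩
    rw [congrFun (hinj t) j]
    by_cases hj : 0 < N.Dc j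
    · have hmLt : (fun l : N.Load => N.mismatch (X t) l.1) = 0 := funext fun l => hmL t ht.le l
      have hval : N.kronField θ₀ (X t) j = N.mismatch (X t) j / N.Dc j := by
        simp only [kronField, dif_pos hj, kronFieldI, hmLt, Matrix.mulVec_zero, Pi.zero_apply,
          sub_zero]
      rw [hval, mismatch, shiftedInjection]
      field_simp
      ring
    · have hD0 : N.Dc j = 0 := le_antisymm (not_lt.1 hj) (hD j)
      have hm := hmL t ht.le ⟨j, hj⟩
      rw [hmis ⟨j, hj⟩] at hm
      rw [hD0, zero_mul]
      linarith
  · have hm := hmL t ht l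
    rw [hmis, ← congrFun (hinj t) l.1] at hm
    linarith
  · intro t ht
    have hcw : ContinuousWithinAt X (Icc 0 (t + 1)) t :=
      (hX (t + 1) t ⟨ht, by linarith⟩).continuousWithinAt
    have hcw' : ContinuousWithinAt X (Ici 0) t := by
      refine hcw.mono_of_mem_nhdsWithin ?_
      have hIio : Iio (t + 1) ∈ 𝓝 t := Iio_mem_nhds (by linarith)
      exact mem_of_superset (inter_mem_nhdsWithin (Ici (0 : ℝ)) hIio)
        fun s hs => ⟨hs.1, hs.2.le⟩
    have hlin : ContinuousWithinAt (fun s : ℝ => fun _ : Fin n => N.avgFrequency * s) (Ici 0) t :=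
      (continuous_pi fun _ => continuous_const.mul continuous_id).continuousWithinAt
    have hsum := hcw'.add hlin
    refine hsum.congr (fun s _ => ?_) ?_
    · funext j; simp [hθdef]
    · funext j; simp [hθdef]
  · have hest := hXest t ht
    have hshape : (θ t - fun i => θ₀ i + N.Dc ⬝ᵥ (θinit - θ₀) / (∑ i, N.Dc i) + N.avgFrequency * t)
        = X t - fun i => θ₀ i + N.Dc ⬝ᵥ (θinit - θ₀) / ∑ i, N.Dc i := by
      funext i; simp only [hθdef, Pi.sub_apply]; ring
    rw [hshape]
    exact hest

end DroopNetwork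

namespace DAPINetwork

variable {n : ℕ} {W : DAPINetwork n}

/-! ## §4 Theorem 8 (ii) with load nodes: the Kron-extended DAPI closed loop is `C¹` on the regular
set; its solutions exist from every initial state near `(θ*, 0)`, stay regular and obey the estimate;
the load constraints are invariant; from CONSISTENT initial data the differential-algebraic closed
loop (load – closed loop)–(secondary control – closed loop) has a solution on `[0, ∞)` converging
exponentially to `(θ* + c𝟙, D_Iω_avg)` -/

/-- Angle rows of the field at inverters. [folklore] -/
private theorem dlField_inl_inv' (θs : Fin n → ℝ) (x : Fin n ⊕ W.Inv → ℝ) (i : W.Inv) :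
    W.dlField θs x (Sum.inl i.1)
      = W.dlFieldI θs (fun j' => x (Sum.inl j')) (fun i' => x (Sum.inr i')) i := by
  simp only [dlField, Sum.elim_inl, dif_pos i.2]

/-- Angle rows of the field at loads. [folklore] -/
private theorem dlField_inl_load' (θs : Fin n → ℝ) (x : Fin n ⊕ W.Inv → ℝ) (l : W.Load) :
    W.dlField θs x (Sum.inl l.1)
      = W.dlFieldL θs (fun j' => x (Sum.inl j')) (fun i' => x (Sum.inr i')) l := by
  simp only [dlField, Sum.elim_inl, dif_neg l.2]

/-- The angle part of a state has sup norm at most that of the state. [folklore] -/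
private theorem norm_inl_le' (x : Fin n ⊕ W.Inv → ℝ) : ‖fun j => x (Sum.inl j)‖ ≤ ‖x‖ :=
  (pi_norm_le_iff_of_nonneg (norm_nonneg x)).2 fun j => norm_le_pi_norm x (Sum.inl j)

/-- `|Σ(D, −k_I)·h| ≤ (Σ D_i + Σ_{V_I} k_i)‖h‖` (sup norm). [folklore] -/
private theorem abs_dlWeights_dotProduct_le' (hD : ∀ i, 0 ≤ W.Dc i)
    (hk : ∀ i : W.Inv, 0 ≤ W.kgain i.1) (h : Fin n ⊕ W.Inv → ℝ) :
    |W.dlWeights ⬝ᵥ h| ≤ (∑ i, W.Dc i + ∑ i : W.Inv, W.kgain i.1) * ‖h‖ := by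
  have hw : ∀ kk, |W.dlWeights kk| * ‖h‖ ≥ |W.dlWeights kk * h kk| := fun kk => by
    rw [abs_mul]
    exact mul_le_mul_of_nonneg_left (by simpa using norm_le_pi_norm h kk) (abs_nonneg _)
  have habs : ∑ kk, |W.dlWeights kk| = ∑ i, W.Dc i + ∑ i : W.Inv, W.kgain i.1 := by
    simp only [Fintype.sum_sum_type, dlWeights, Sum.elim_inl, Sum.elim_inr, abs_neg]
    congr 1
    · exact Finset.sum_congr rfl fun i _ => abs_of_nonneg (hD i)
    · exact Finset.sum_congr rfl fun i _ => abs_of_nonneg (hk i)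
  calc |W.dlWeights ⬝ᵥ h| = |∑ kk, W.dlWeights kk * h kk| := rfl
    _ ≤ ∑ kk, |W.dlWeights kk * h kk| := Finset.abs_sum_le_sum_abs _ _
    _ ≤ ∑ kk, |W.dlWeights kk| * ‖h‖ := Finset.sum_le_sum fun kk _ => hw kk
    _ = (∑ i, W.Dc i + ∑ i : W.Inv, W.kgain i.1) * ‖h‖ := by rw [← Finset.sum_mul, habs]

/-- The angle part `(θ, p̃) ↦ θ` is `C¹` (linear). [folklore] -/
private theorem contDiff_inlPart : ContDiff ℝ 1 fun x : Fin n ⊕ W.Inv → ℝ => fun j => x (Sum.inl j) :=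
  contDiff_pi' fun j => contDiff_apply ℝ ℝ (Sum.inl j)

/-- The inverter angle rows of the Kron-extended DAPI closed loop are `C¹` everywhere.
[cite: SimpsonporcoDorflerBullo2013, App. C eqs. (rot2)] -/
theorem contDiff_dlFieldI (θs : Fin n → ℝ) (i : W.Inv) :
    ContDiff ℝ 1 fun x : Fin n ⊕ W.Inv → ℝ =>
      W.dlFieldI θs (fun j => x (Sum.inl j)) (fun i' => x (Sum.inr i')) i := by
  unfold dlFieldI
  have h1 : ContDiff ℝ 1 fun x : Fin n ⊕ W.Inv → ℝ => W.kronFieldI θs (fun j => x (Sum.inl j)) i :=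
    (DroopNetwork.contDiff_kronFieldI (N := W.toDroopNetwork) θs i).comp contDiff_inlPart
  exact h1.sub ((contDiff_apply ℝ ℝ (Sum.inr i)).div_const _)

/-- The load angle rows are `C¹` on the regular set `{det L_LL(θ) ≠ 0}`.
[cite: SimpsonporcoDorflerBullo2013, App. C («regular fixed point»)] -/
theorem contDiffOn_dlFieldL (θs : Fin n → ℝ) (l : W.Load) :
    ContDiffOn ℝ 1 (fun x : Fin n ⊕ W.Inv → ℝ =>
      W.dlFieldL θs (fun j => x (Sum.inl j)) (fun i' => x (Sum.inr i')) l)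
      {x | (W.lapLL fun j => x (Sum.inl j)).det ≠ 0} := by
  unfold dlFieldL
  simp only [Pi.add_apply, Matrix.mulVec, dotProduct]
  have hmaps : MapsTo (fun x : Fin n ⊕ W.Inv → ℝ => fun j => x (Sum.inl j))
      {x | (W.lapLL fun j => x (Sum.inl j)).det ≠ 0}
      {θ : Fin n → ℝ | (W.lapLL θ).det ≠ 0} := fun x hx => hx
  refine ContDiffOn.add (ContDiffOn.sum fun i _ => ?_) (ContDiffOn.sum fun l' _ => ?_)
  · have h1 : ContDiffOn ℝ 1 (fun x : Fin n ⊕ W.Inv → ℝ => W.elim (fun j => x (Sum.inl j)) l i)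
        {x | (W.lapLL fun j => x (Sum.inl j)).det ≠ 0} :=
      (DroopNetwork.contDiffOn_elim (N := W.toDroopNetwork) l i).comp
        contDiff_inlPart.contDiffOn hmaps
    exact h1.mul (contDiff_dlFieldI θs i).contDiffOn
  · have h1 : ContDiff ℝ 1 fun x : Fin n ⊕ W.Inv → ℝ => W.mismatch (fun j => x (Sum.inl j)) l'.1 :=
      (DroopNetwork.contDiff_mismatch (N := W.toDroopNetwork) l'.1).comp contDiff_inlPart
    exact (contDiff_const.mul h1).contDiffOn

/-- The secondary rows are `C¹` everywhere. [cite: SimpsonporcoDorflerBullo2013, App. C eqs. (rot2)] -/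
theorem contDiff_dlFieldP (θs : Fin n → ℝ) (i : W.Inv) :
    ContDiff ℝ 1 fun x : Fin n ⊕ W.Inv → ℝ =>
      W.dlFieldP θs (fun j => x (Sum.inl j)) (fun i' => x (Sum.inr i')) i := by
  unfold dlFieldP
  refine ContDiff.div_const (ContDiff.sub (contDiff_const.mul (contDiff_dlFieldI θs i)) ?_) _
  exact ContDiff.sum fun j _ => contDiff_const.mul
    (((contDiff_apply ℝ ℝ (Sum.inr i)).div_const _).sub ((contDiff_apply ℝ ℝ (Sum.inr j)).div_const _))

/-- **The Kron-extended DAPI closed loop `dlField θ*` is `C¹` on the regular set**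
`{(θ, p̃) | det L_LL(θ) ≠ 0}`. [cite: SimpsonporcoDorflerBullo2013, App. C («we linearize the DAE … about the regular fixed point»)] -/
theorem contDiffOn_dlField (θs : Fin n → ℝ) :
    ContDiffOn ℝ 1 (W.dlField θs) {x | (W.lapLL fun j => x (Sum.inl j)).det ≠ 0} := by
  refine contDiffOn_pi' fun kk => ?_
  cases kk with
  | inl j =>
    by_cases hj : 0 < W.Dc j
    · have h : (fun x => W.dlField θs x (Sum.inl j)) = fun x =>
          W.dlFieldI θs (fun j' => x (Sum.inl j')) (fun i' => x (Sum.inr i')) ⟨j, hj⟩ :=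
        funext fun x => dlField_inl_inv' θs x ⟨j, hj⟩
      rw [h]; exact (contDiff_dlFieldI θs ⟨j, hj⟩).contDiffOn
    · have h : (fun x => W.dlField θs x (Sum.inl j)) = fun x =>
          W.dlFieldL θs (fun j' => x (Sum.inl j')) (fun i' => x (Sum.inr i')) ⟨j, hj⟩ :=
        funext fun x => dlField_inl_load' θs x ⟨j, hj⟩
      rw [h]; exact contDiffOn_dlFieldL θs ⟨j, hj⟩
  | inr i =>
    have h : (fun x => W.dlField θs x (Sum.inr i)) = fun x =>
        W.dlFieldP θs (fun j' => x (Sum.inl j')) (fun i' => x (Sum.inr i')) i :=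
      funext fun x => by simp only [dlField, Sum.elim_inr]
    rw [h]; exact (contDiff_dlFieldP θs i).contDiffOn

/-- The regular set of the extended state space is open.
[cite: SimpsonporcoDorflerBullo2013, App. C («the regular fixed point `(θ*, p̃*)`»)] -/
theorem isOpen_regular :
    IsOpen {x : Fin n ⊕ W.Inv → ℝ | (W.lapLL fun j => x (Sum.inl j)).det ≠ 0} :=
  isOpen_det_ne_zero fun a b =>
    (DroopNetwork.contDiff_lap (N := W.toDroopNetwork) a.1 b.1).comp contDiff_inlPart

/-- **Solutions of the Kron-extended DAPI closed loop exist on `[0, ∞)` from every initial state near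
`(θ*, 0)`**, stay regular and obey the exponential estimate modulo the rotation (hypotheses of
`dlEquilibrium_locally_expStable_of_certificates`; confinement by its estimate, global existence by
`Literature.Analysis.ODE.exists_global_solution_of_confined`).
[cite: SimpsonporcoDorflerBullo2013, Theorem 8 (ii) and App. C; Teschl2012, Cor. 2.15] -/
theorem exists_dlSolution (hD : ∀ i, 0 ≤ W.Dc i) (i₀ : W.Inv) (hk : ∀ i : W.Inv, 0 < W.kgain i.1)
    (hY : ∀ i j, W.Yabs i j = W.Yabs j i) (hcs : ∀ i j : W.Inv, W.comm i.1 j.1 = W.comm j.1 i.1)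
    {θs : Fin n → ℝ} (hθs : W.IsAuxEquilibrium θs)
    (hpsd : ∀ u : Fin n → ℝ, 0 ≤ ∑ i, u i * ∑ j, W.linWeight θs i j * (u i - u j))
    (hker : ∀ u : Fin n → ℝ, ∑ i, u i * ∑ j, W.linWeight θs i j * (u i - u j) = 0 →
      ∃ a : ℝ, u = fun _ => a)
    (hcpsd : ∀ u : W.Inv → ℝ, 0 ≤ ∑ i, u i * ∑ j, W.comm i.1 j.1 * (u i - u j))
    (hcker : ∀ u : W.Inv → ℝ, ∑ i, u i * ∑ j, W.comm i.1 j.1 * (u i - u j) = 0 →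
      ∃ a : ℝ, u = fun _ => a) :
    ∃ ρ > 0, ∃ k > 0, ∃ lam > 0, ∀ x : Fin n ⊕ W.Inv → ℝ, ‖x - W.lphase θs 0‖ < ρ →
      ∃ X : ℝ → Fin n ⊕ W.Inv → ℝ, X 0 = x ∧
        (∀ T : ℝ, ∀ t ∈ Icc 0 T, HasDerivWithinAt X (W.dlField θs (X t)) (Icc 0 T) t) ∧
        (∀ t : ℝ, 0 ≤ t → IsUnit (W.lapLL fun j => X t (Sum.inl j)).det) ∧
        ∀ t : ℝ, 0 ≤ t →
          ‖X t - fun kk => W.lphase θs 0 kk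
              + W.dlWeights ⬝ᵥ (x - W.lphase θs 0) / (∑ i, W.Dc i) * W.dlRot kk‖
            ≤ k * ‖x - fun kk => W.lphase θs 0 kk
                + W.dlWeights ⬝ᵥ (x - W.lphase θs 0) / (∑ i, W.Dc i) * W.dlRot kk‖
              * Real.exp (-lam * t) := by
  classical
  obtain ⟨ρ, hρ, k, hk', lam, hlam, H⟩ :=
    dl_expStable_within_leaf hD i₀ hk hY hcs hθs hpsd hker hcpsd hcker
  have Hmod := dl_expStable_modRotation_of_within_leaf hD i₀ hk H
  have hDs : 0 < ∑ i, W.Dc i :=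
    lt_of_lt_of_le i₀.2 (Finset.single_le_sum (fun i _ => hD i) (Finset.mem_univ i₀.1))
  obtain ⟨K, hKdef⟩ : ∃ K : ℝ, K = (∑ i, W.Dc i + ∑ i : W.Inv, W.kgain i.1) / ∑ i, W.Dc i :=
    ⟨_, rfl⟩
  have hK0 : 0 ≤ K := hKdef ▸ div_nonneg
    (add_nonneg hDs.le (Finset.sum_nonneg fun i _ => (hk i).le)) hDs.le
  rw [← hKdef] at Hmod
  have hU0 : IsUnit (W.lapLL θs).det :=
    DroopNetwork.isUnit_lapLL_det (N := W.toDroopNetwork) hker i₀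
  obtain ⟨r, hr, hball⟩ := DroopNetwork.exists_ball_isUnit_lapLL (N := W.toDroopNetwork) hU0
  set ρ' : ℝ := min (ρ / (1 + K)) (r / ((1 + K) * (k + 2))) with hρ'
  have hρ'pos : 0 < ρ' := lt_min (by positivity) (by positivity)
  have hρ'ρ : ρ' ≤ ρ / (1 + K) := min_le_left _ _
  have hρ'r : (1 + K) * (k + 2) * ρ' ≤ r := by
    have := min_le_right (ρ / (1 + K)) (r / ((1 + K) * (k + 2)))
    rw [← hρ'] at this
    calc (1 + K) * (k + 2) * ρ' ≤ (1 + K) * (k + 2) * (r / ((1 + K) * (k + 2))) :=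
          mul_le_mul_of_nonneg_left this (by positivity)
      _ = r := by field_simp
  set B : ℝ := (1 + K) * ρ' with hBdef
  have hkB : k * B + 2 * B ≤ r := by
    have h : k * B + 2 * B = (1 + K) * (k + 2) * ρ' := by rw [hBdef]; ring
    rw [h]; exact hρ'r
  have hBpos : 0 < B := by positivity
  have hkBr : k * B < r := by linarith
  refine ⟨ρ', hρ'pos, k, hk', lam, hlam, fun x hx => ?_⟩
  set x₀ : Fin n ⊕ W.Inv → ℝ := W.lphase θs 0 with hx₀
  -- the rotation selected by `x` and the confining ball
  set c : ℝ := W.dlWeights ⬝ᵥ (x - x₀) / ∑ i, W.Dc i with hcdef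
  set xc : Fin n ⊕ W.Inv → ℝ := fun kk => x₀ kk + c * W.dlRot kk with hxc
  have hcle : |c| ≤ K * ‖x - x₀‖ := by
    rw [hcdef, abs_div, abs_of_pos hDs, div_le_iff₀ hDs, hKdef]
    calc |W.dlWeights ⬝ᵥ (x - x₀)| ≤ (∑ i, W.Dc i + ∑ i : W.Inv, W.kgain i.1) * ‖x - x₀‖ :=
          abs_dlWeights_dotProduct_le' hD (fun i => (hk i).le) _
      _ = (∑ i, W.Dc i + ∑ i : W.Inv, W.kgain i.1) / (∑ i, W.Dc i) * ‖x - x₀‖ * ∑ i, W.Dc i := by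
          field_simp
  have hB0 : ‖x - xc‖ ≤ B := by
    have hdecomp : x - xc = (x - x₀) - fun kk => c * W.dlRot kk := by
      funext kk; simp [hxc]; ring
    have hrot : ‖fun kk : Fin n ⊕ W.Inv => c * W.dlRot kk‖ ≤ |c| := by
      refine (pi_norm_le_iff_of_nonneg (abs_nonneg c)).2 fun kk => ?_
      cases kk with
      | inl i => simp [dlRot]
      | inr i => simp [dlRot]
    have hKX : K * ‖x - x₀‖ ≤ K * ρ' := mul_le_mul_of_nonneg_left hx.le hK0
    rw [hdecomp]
    calc ‖(x - x₀) - fun kk : Fin n ⊕ W.Inv => c * W.dlRot kk‖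
        ≤ ‖x - x₀‖ + ‖fun kk : Fin n ⊕ W.Inv => c * W.dlRot kk‖ := norm_sub_le _ _
      _ ≤ ρ' + K * ρ' := by linarith [hrot, hcle, hx.le]
      _ = B := by rw [hBdef]; ring
  set Kset : Set (Fin n ⊕ W.Inv → ℝ) := closedBall xc (k * ‖x - xc‖) with hKset
  have hKcpt : IsCompact Kset := isCompact_closedBall _ _
  have hKO : Kset ⊆ {y : Fin n ⊕ W.Inv → ℝ | (W.lapLL fun j => y (Sum.inl j)).det ≠ 0} := by
    intro y hy
    rw [hKset, mem_closedBall, dist_eq_norm] at hy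
    have hθ : (fun j => (y - xc) (Sum.inl j)) = (fun j => y (Sum.inl j)) - fun j => θs j + c := by
      funext j; simp [hxc, hx₀, lphase, dlRot]
    have hlt : ‖(fun j => y (Sum.inl j)) - fun j => θs j + c‖ < r := by
      calc ‖(fun j => y (Sum.inl j)) - fun j => θs j + c‖ = ‖fun j => (y - xc) (Sum.inl j)‖ := by
            rw [hθ]
        _ ≤ ‖y - xc‖ := norm_inl_le' _
        _ ≤ k * ‖x - xc‖ := hy
        _ ≤ k * B := mul_le_mul_of_nonneg_left hB0 hk'.le
        _ < r := hkBr
    exact (hball _ c hlt).ne_zero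
  -- every solution from `x` is confined to `Kset`
  have hconf : ∀ s : ℝ, ∀ X : ℝ → Fin n ⊕ W.Inv → ℝ, X 0 = x →
      (∀ t ∈ Icc 0 s, HasDerivWithinAt X (W.dlField θs (X t)) (Icc 0 s) t) →
      ∀ t ∈ Icc 0 s, X t ∈ Kset := by
    intro s X hX0 hX t ht
    have h0 : ‖X 0 - x₀‖ < ρ / (1 + K) := by rw [hX0]; exact lt_of_lt_of_le hx hρ'ρ
    have hest := Hmod X s hX h0 t ht
    rw [hX0] at hest
    rw [hKset, mem_closedBall, dist_eq_norm]
    have hexp : Real.exp (-lam * t) ≤ 1 := Real.exp_le_one_iff.2 (by nlinarith [ht.1])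
    calc ‖X t - xc‖ ≤ k * ‖x - xc‖ * Real.exp (-lam * t) := hest
      _ ≤ k * ‖x - xc‖ := mul_le_of_le_one_right (by positivity) hexp
  obtain ⟨X, hX0, hX⟩ := Literature.Analysis.ODE.exists_global_solution_of_confined
    isOpen_regular (contDiffOn_dlField θs) hKcpt hKO hconf
  refine ⟨X, hX0, hX, fun t ht => ?_, fun t ht => ?_⟩
  · exact isUnit_iff_ne_zero.2 (hKO (hconf t X hX0 (hX t) t ⟨ht, le_rfl⟩))
  · have h0 : ‖X 0 - x₀‖ < ρ / (1 + K) := by rw [hX0]; exact lt_of_lt_of_le hx hρ'ρ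
    have hest := Hmod X t (hX t) h0 t ⟨ht, le_rfl⟩
    rw [hX0] at hest
    exact hest

/-- Splitting a sum over the nodes into inverter and load nodes. [folklore] -/
private theorem sum_split₄ {M : Type*} [AddCommMonoid M] (f : Fin n → M) :
    ∑ j, f j = ∑ i : W.Inv, f i.1 + ∑ l : W.Load, f l.1 :=
  (Fintype.sum_subtype_add_sum_subtype (fun j => 0 < W.Dc j) f).symm

/-- The derivative of the mismatch, applied: `−(L(θ)h)_i`. [folklore] -/
private theorem mismatchDeriv_apply₄ (θs : Fin n → ℝ) (i : Fin n) (h : Fin n → ℝ) :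
    ((-(∑ j, W.linWeight θs i j •
        ((ContinuousLinearMap.proj i : (Fin n → ℝ) →L[ℝ] ℝ) - ContinuousLinearMap.proj j)))
        : (Fin n → ℝ) →L[ℝ] ℝ) h
      = -((W.lap θs *ᵥ h) i) := by
  rw [DroopNetwork.lap_mulVec]
  simp only [neg_apply, _root_.sum_apply, smul_apply, sub_apply, ContinuousLinearMap.proj_apply,
    smul_eq_mul]

/-- Along the Kron-extended DAPI closed loop the load mismatches obey a LINEAR equation: at a
regular state, `(L(θ)θ̇)_l = (L_LL(θ)L_LL(θ*)⁻¹m_L(θ))_l`. [cite: SimpsonporcoDorflerBullo2013, App. C] -/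
theorem lap_mulVec_dlField_load (θs : Fin n → ℝ) {x : Fin n ⊕ W.Inv → ℝ}
    (hU : IsUnit (W.lapLL fun j => x (Sum.inl j)).det) (l : W.Load) :
    (W.lap (fun j => x (Sum.inl j)) *ᵥ fun j => W.dlField θs x (Sum.inl j)) l.1
      = ((W.lapLL (fun j => x (Sum.inl j)) * (W.lapLL θs)⁻¹) *ᵥ
          fun l' : W.Load => W.mismatch (fun j => x (Sum.inl j)) l'.1) l := by
  classical
  set θ : Fin n → ℝ := fun j => x (Sum.inl j) with hθ
  set q : W.Inv → ℝ := fun i' => x (Sum.inr i') with hq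
  have hFI : ∀ i : W.Inv, W.dlField θs x (Sum.inl i.1) = W.dlFieldI θs θ q i :=
    fun i => dlField_inl_inv' θs x i
  have hFL : ∀ l' : W.Load, W.dlField θs x (Sum.inl l'.1) = W.dlFieldL θs θ q l' :=
    fun l' => dlField_inl_load' θs x l'
  have h1 : (W.lap θ *ᵥ fun j => W.dlField θs x (Sum.inl j)) l.1
      = (W.lapLI θ *ᵥ W.dlFieldI θs θ q) l + (W.lapLL θ *ᵥ W.dlFieldL θs θ q) l := by
    simp only [Matrix.mulVec, dotProduct]
    rw [sum_split₄ (W := W)]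
    simp only [DroopNetwork.lapLI, DroopNetwork.lapLL, hFI, hFL]
  have h2 : W.lapLL θ *ᵥ W.dlFieldL θs θ q
      = -(W.lapLI θ *ᵥ W.dlFieldI θs θ q)
        + (W.lapLL θ * (W.lapLL θs)⁻¹) *ᵥ fun l' : W.Load => W.mismatch θ l'.1 := by
    rw [dlFieldL, Matrix.mulVec_add, Matrix.mulVec_mulVec, Matrix.mulVec_mulVec,
      DroopNetwork.lapLL_mul_elim (N := W.toDroopNetwork) hU, Matrix.neg_mulVec]
  rw [h1, h2, Pi.add_apply, Pi.neg_apply]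
  ring

/-- **The load constraints are invariant** along a regular solution of the Kron-extended DAPI
closed loop starting on the constraint manifold (Grönwall on `ẏ = −L_LL(θ(t))L_LL(θ*)⁻¹y`).
[cite: SimpsonporcoDorflerBullo2013, App. C («eliminate the resulting algebraic equations»)] -/
theorem mismatch_load_eq_zero_of_dlSolution (θs : Fin n → ℝ) {X : ℝ → Fin n ⊕ W.Inv → ℝ} {T : ℝ}
    (hX : ∀ t ∈ Icc 0 T, HasDerivWithinAt X (W.dlField θs (X t)) (Icc 0 T) t)
    (hU : ∀ t ∈ Icc 0 T, IsUnit (W.lapLL fun j => X t (Sum.inl j)).det)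
    (h0 : ∀ l : W.Load, W.mismatch (fun j => X 0 (Sum.inl j)) l.1 = 0) :
    ∀ t ∈ Icc 0 T, ∀ l : W.Load, W.mismatch (fun j => X t (Sum.inl j)) l.1 = 0 := by
  classical
  set y : ℝ → W.Load → ℝ := fun t l => W.mismatch (fun j => X t (Sum.inl j)) l.1 with hydef
  set A : ℝ → Matrix W.Load W.Load ℝ :=
    fun t => W.lapLL (fun j => X t (Sum.inl j)) * (W.lapLL θs)⁻¹ with hAdef
  have hXθ : ∀ t ∈ Icc 0 T, HasDerivWithinAt (fun s => fun j => X s (Sum.inl j))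
      (fun j => W.dlField θs (X t) (Sum.inl j)) (Icc 0 T) t := fun t ht =>
    hasDerivWithinAt_pi.2 fun j => (hasDerivWithinAt_pi.1 (hX t ht)) (Sum.inl j)
  have hyderiv : ∀ t ∈ Icc 0 T, HasDerivWithinAt y (-(A t *ᵥ y t)) (Icc 0 T) t := by
    intro t ht
    refine hasDerivWithinAt_pi.2 fun l => ?_
    have hF := DroopNetwork.hasFDerivAt_mismatch (N := W.toDroopNetwork)
      (fun j => X t (Sum.inl j)) l.1
    have h1 := hF.comp_hasDerivWithinAt t (hXθ t ht)
    rw [mismatchDeriv_apply₄, lap_mulVec_dlField_load θs (hU t ht) l] at h1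
    exact h1
  have hXcont : ContinuousOn (fun s => fun j => X s (Sum.inl j)) (Icc 0 T) :=
    fun t ht => (hXθ t ht).continuousWithinAt
  have hAcont : ∀ a b : W.Load, ContinuousOn (fun t => A t a b) (Icc 0 T) := by
    intro a b
    have hform : (fun t => A t a b)
        = fun t => ∑ l', W.lapLL (fun j => X t (Sum.inl j)) a l' * (W.lapLL θs)⁻¹ l' b := by
      funext t; simp [hAdef, Matrix.mul_apply]
    rw [hform]
    refine continuousOn_finsetSum _ fun l' _ => ContinuousOn.mul ?_ continuousOn_const
    exact ((DroopNetwork.contDiff_lap (N := W.toDroopNetwork) a.1 l'.1).continuous).comp_continuousOn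
      hXcont
  have hy0 : y 0 = 0 := funext fun l => h0 l
  have hzero := eq_zero_of_linear_of_eq_zero hyderiv hAcont hy0
  intro t ht l
  have := congrFun (hzero t ht) l
  simpa [hydef] using this

/-- **SPDB2013 Theorem 8 (ii) WITH LOAD NODES — existence of the motions and their convergence.**
Under the hypotheses of `equilibrium_locally_expStable_loads_of_certificates` there are
`ρ, k, λ > 0` such that from EVERY CONSISTENT initial condition `(θ⁰, p⁰)` (`P*_l = P_e,l(θ⁰)` at
the loads) with `‖(θ⁰ − θ*, p⁰ − D_Iω_avg)‖ < ρ` there is a solution `(θ, p)` of the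
differential-algebraic closed loop (load – closed loop)–(secondary control – closed loop) on
`[0, ∞)` — `θ(0) = θ⁰`, `p(0) = p⁰`, the equations at every `t > 0` (`IsSolutionLoadsAt`), the load
constraints at every `t ≥ 0`, the state continuous on `[0, ∞)` — and it satisfies for all `t ≥ 0`
`‖(θ(t) − (θ* + c𝟙), p(t) − D_Iω_avg)‖ ≤ k‖(θ⁰ − (θ* + c𝟙), p⁰ − D_Iω_avg)‖e^{−λt}`,
`c = (Σ_i D_i(θ⁰_i − θ*_i) − Σ_{V_I} k_i(p⁰_i − D_iω_avg))/Σ_i D_i`.  (So the «EVERY solution»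
clause of Theorem 8 (ii)'s typed form is not vacuous.)  MODEL: droop-controlled inverters with the
DAPI secondary loop, constant-power loads (algebraic rows), lossless, constant voltages.
[cite: SimpsonporcoDorflerBullo2013, §5 Theorem 8 (ii) and App. C; Teschl2012, Cor. 2.15] -/
theorem exists_solution_loads (hD : ∀ i, 0 ≤ W.Dc i) (i₀ : W.Inv) (hk : ∀ i : W.Inv, 0 < W.kgain i.1)
    (hY : ∀ i j, W.Yabs i j = W.Yabs j i) (hcs : ∀ i j : W.Inv, W.comm i.1 j.1 = W.comm j.1 i.1)
    {θs : Fin n → ℝ} (hθs : W.IsAuxEquilibrium θs)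
    (hpsd : ∀ u : Fin n → ℝ, 0 ≤ ∑ i, u i * ∑ j, W.linWeight θs i j * (u i - u j))
    (hker : ∀ u : Fin n → ℝ, ∑ i, u i * ∑ j, W.linWeight θs i j * (u i - u j) = 0 →
      ∃ a : ℝ, u = fun _ => a)
    (hcpsd : ∀ u : W.Inv → ℝ, 0 ≤ ∑ i, u i * ∑ j, W.comm i.1 j.1 * (u i - u j))
    (hcker : ∀ u : W.Inv → ℝ, ∑ i, u i * ∑ j, W.comm i.1 j.1 * (u i - u j) = 0 →
      ∃ a : ℝ, u = fun _ => a) :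
    ∃ ρ > 0, ∃ k > 0, ∃ lam > 0, ∀ (θinit : Fin n → ℝ) (pinit : W.Inv → ℝ),
      ‖W.lphase (θinit - θs) (fun i => pinit i - W.Dc i.1 * W.avgFrequency)‖ < ρ →
      (∀ l : W.Load, W.Pstar l.1 = W.injection θinit l.1) →
      ∃ (θ : ℝ → Fin n → ℝ) (p : ℝ → W.Inv → ℝ), θ 0 = θinit ∧ p 0 = pinit ∧
        (∀ t : ℝ, 0 < t → W.IsSolutionLoadsAt θ p t) ∧
        (∀ t : ℝ, 0 ≤ t → ∀ l : W.Load, W.Pstar l.1 = W.injection (θ t) l.1) ∧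
        ContinuousOn (fun t => W.lphase (θ t) (fun i => p t i - W.Dc i.1 * W.avgFrequency))
          (Ici 0) ∧
        ∀ t : ℝ, 0 ≤ t →
          ‖W.lphase (fun j => θ t j - (θs j + (∑ j', W.Dc j' * (θinit j' - θs j')
                - ∑ i : W.Inv, W.kgain i.1 * (pinit i - W.Dc i.1 * W.avgFrequency)) / ∑ j', W.Dc j'))
              (fun i => p t i - W.Dc i.1 * W.avgFrequency)‖
            ≤ k * ‖W.lphase (fun j => θinit j - (θs j + (∑ j', W.Dc j' * (θinit j' - θs j')
                - ∑ i : W.Inv, W.kgain i.1 * (pinit i - W.Dc i.1 * W.avgFrequency)) / ∑ j', W.Dc j'))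
              (fun i => pinit i - W.Dc i.1 * W.avgFrequency)‖ * Real.exp (-lam * t) := by
  classical
  obtain ⟨ρ, hρ, k, hk', lam, hlam, H⟩ :=
    exists_dlSolution hD i₀ hk hY hcs hθs hpsd hker hcpsd hcker
  refine ⟨ρ, hρ, k, hk', lam, hlam, fun θinit pinit hinit hcons => ?_⟩
  set x₀ : Fin n ⊕ W.Inv → ℝ := W.lphase θs 0 with hx₀
  set x : Fin n ⊕ W.Inv → ℝ :=
    W.lphase θinit (fun i => pinit i - W.Dc i.1 * W.avgFrequency) with hxdef
  have hdev : x - x₀ = W.lphase (θinit - θs) (fun i => pinit i - W.Dc i.1 * W.avgFrequency) := by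
    funext kk
    cases kk with
    | inl j => simp [hxdef, hx₀, lphase]
    | inr i => simp [hxdef, hx₀, lphase]
  have hx : ‖x - x₀‖ < ρ := by rw [hdev]; exact hinit
  obtain ⟨X, hX0, hX, hXU, hXest⟩ := H x hx
  -- the load constraints along `X`
  have hmis : ∀ (l : W.Load) (θ : Fin n → ℝ),
      W.mismatch θ l.1 = W.Pstar l.1 - W.injection θ l.1 := fun l θ => by
    rw [DroopNetwork.mismatch, DroopNetwork.shiftedInjection,
      DroopNetwork.dc_load (N := W.toDroopNetwork) hD l, mul_zero, sub_zero]
  have hθ0 : (fun j => X 0 (Sum.inl j)) = θinit := by funext j; simp [hX0, hxdef, lphase]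
  have hm0 : ∀ l : W.Load, W.mismatch (fun j => X 0 (Sum.inl j)) l.1 = 0 := fun l => by
    rw [hθ0, hmis, hcons l, sub_self]
  have hmL : ∀ t, 0 ≤ t → ∀ l : W.Load, W.mismatch (fun j => X t (Sum.inl j)) l.1 = 0 :=
    fun t ht => mismatch_load_eq_zero_of_dlSolution θs (hX t) (fun s hs => hXU s hs.1) hm0 t
      ⟨ht, le_rfl⟩
  -- the motion `(θ, p)`
  set θ : ℝ → Fin n → ℝ := fun s j => X s (Sum.inl j) with hθdef
  set p : ℝ → W.Inv → ℝ := fun s i => X s (Sum.inr i) + W.Dc i.1 * W.avgFrequency with hpdef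
  have hstate : ∀ s, W.lphase (θ s) (fun i => p s i - W.Dc i.1 * W.avgFrequency) = X s := by
    intro s; funext kk
    cases kk with
    | inl j => simp [hθdef, lphase]
    | inr i => simp [hpdef, lphase]
  refine ⟨θ, p, hθ0, ?_, fun t ht => ?_, fun t ht l => ?_, ?_, fun t ht => ?_⟩
  · funext i; simp [hpdef, hX0, hxdef, lphase]
  · -- the equations at time `t > 0`
    have hder : HasDerivAt X (W.dlField θs (X t)) t :=
      (hX (t + 1) t ⟨ht.le, by linarith⟩).hasDerivAt (Icc_mem_nhds ht (by linarith))
    have hcomp : ∀ kk, HasDerivAt (fun s => X s kk) (W.dlField θs (X t) kk) t :=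
      fun kk => hasDerivAt_pi.1 hder kk
    set q : W.Inv → ℝ := fun i' => X t (Sum.inr i') with hq
    have hθt : (fun j' => X t (Sum.inl j')) = θ t := rfl
    have hmLt : (fun l : W.Load => W.mismatch (θ t) l.1) = 0 := funext fun l => hmL t ht.le l
    have hFI : ∀ i : W.Inv, W.dlFieldI θs (θ t) q i
        = (W.Pstar i.1 - p t i - W.injection (θ t) i.1) / W.Dc i.1 := by
      intro i
      simp only [dlFieldI, DroopNetwork.kronFieldI, hmLt, Matrix.mulVec_zero, Pi.zero_apply,
        sub_zero]
      rw [DroopNetwork.mismatch, DroopNetwork.shiftedInjection, hq, hpdef, div_sub_div_same]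
      congr 1
      ring
    have hquot : ∀ i j : W.Inv, q i / W.Dc i.1 - q j / W.Dc j.1
        = p t i / W.Dc i.1 - p t j / W.Dc j.1 := by
      intro i j
      simp only [hq, hpdef]
      rw [add_div, add_div, mul_div_cancel_left₀ _ i.2.ne', mul_div_cancel_left₀ _ j.2.ne']
      ring
    refine ⟨fun i => ⟨?_, ?_⟩, fun l => ⟨⟨_, hcomp (Sum.inl l.1)⟩, ?_⟩⟩
    · have hval : W.dlField θs (X t) (Sum.inl i.1)
          = (W.Pstar i.1 - p t i - W.injection (θ t) i.1) / W.Dc i.1 := by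
        rw [dlField_inl_inv', hθt, ← hFI i]
      have h := hcomp (Sum.inl i.1)
      rw [hval] at h
      exact h
    · have hval : W.dlField θs (X t) (Sum.inr i)
          = (W.Pstar i.1 - p t i - W.injection (θ t) i.1
              - ∑ j : W.Inv, W.comm i.1 j.1 * (p t i / W.Dc i.1 - p t j / W.Dc j.1)) / W.kgain i.1 := by
        have h1 : W.dlField θs (X t) (Sum.inr i) = W.dlFieldP θs (θ t) q i := by
          simp only [dlField, Sum.elim_inr, hθt, hq]
        rw [h1, dlFieldP, hFI i]
        simp only [hquot, mul_div_cancel₀ _ i.2.ne']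
      have h := (hcomp (Sum.inr i)).add_const (W.Dc i.1 * W.avgFrequency)
      rw [hval] at h
      exact h
    · have hm := hmL t ht.le l
      rw [hmis] at hm
      linarith
  · have hm := hmL t ht l
    rw [hmis] at hm
    show W.Pstar l.1 = W.injection (θ t) l.1
    linarith
  · intro t ht
    rw [show (fun t => W.lphase (θ t) (fun i => p t i - W.Dc i.1 * W.avgFrequency)) = X from
      funext hstate]
    have hcw : ContinuousWithinAt X (Icc 0 (t + 1)) t :=
      (hX (t + 1) t ⟨ht, by linarith⟩).continuousWithinAt
    refine hcw.mono_of_mem_nhdsWithin ?_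
    have hIio : Iio (t + 1) ∈ 𝓝 t := Iio_mem_nhds (by linarith)
    exact mem_of_superset (inter_mem_nhdsWithin (Ici (0 : ℝ)) hIio) fun s hs => ⟨hs.1, hs.2.le⟩
  · have hest := hXest t ht
    have hcval : W.dlWeights ⬝ᵥ (x - x₀) = ∑ j', W.Dc j' * (θinit j' - θs j')
        - ∑ i : W.Inv, W.kgain i.1 * (pinit i - W.Dc i.1 * W.avgFrequency) := by
      rw [hdev]
      simp only [dotProduct, Fintype.sum_sum_type, dlWeights, lphase, Sum.elim_inl, Sum.elim_inr,
        Pi.sub_apply, neg_mul, Finset.sum_neg_distrib]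
      ring
    have hshape : ∀ (C : ℝ) (s : ℝ), (X s - fun kk => x₀ kk + C * W.dlRot kk)
        = W.lphase (fun j => θ s j - (θs j + C)) (fun i => p s i - W.Dc i.1 * W.avgFrequency) := by
      intro C s
      funext kk
      cases kk with
      | inl j => simp [hθdef, hx₀, lphase, dlRot]
      | inr i => simp [hpdef, hx₀, lphase, dlRot]
    have hshape0 : ∀ C : ℝ, (x - fun kk => x₀ kk + C * W.dlRot kk)
        = W.lphase (fun j => θinit j - (θs j + C)) (fun i => pinit i - W.Dc i.1 * W.avgFrequency) := by
      intro C
      funext kk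
      cases kk with
      | inl j => simp [hxdef, hx₀, lphase, dlRot]
      | inr i => simp [hxdef, hx₀, lphase, dlRot]
    rw [hcval, hshape, hshape0] at hest
    exact hest

end DAPINetwork

end Literature.MathematicalPhysics.PowerSystems

end
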